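import Summits.QuantumFields.QCD.Theorems.HeatSlicedQuarksRobustYangMillsHandoverSplit
import Summits.QuantumFields.QCD.Theorems.RobustYangMillsHandover.Negative.GapClauses

/-!
# Strategy census r1 (REDIRECT, second opinion) — kernel-checked companion

Crux `stmt-QuantumFields-8892`, `HeatSlicedQuarks.RobustYangMillsHandover := ContinuumQCDExists → QCD`.
Companion to `STRATEGY-CENSUS-r1.md` (strategist r1, 2026-08-17).  Elementary logic over the tree's
definitions; nothing here asserts a Theses decl and nothing is sorried.

* §1 THE TWO-PIECE RE-CUT.  The landed three-piece split (`Split.RobustYangMillsHandover_of_subs`,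
  p140732) is re-cut along TECHNIQUE rather than along the pin: piece α `LatticeChiralEnvelope` carries
  ALL lattice spectral content (pointwise lattice gap above some offset `P` and no uniform rate just
  above `P` — the minimal lattice profile `QCDOf` itself demands at its pin, `qcdOf_envelope`), piece β
  `ContinuumCompletion` carries ALL continuum content (gapped OS data above every pointwise-gapped
  offset).  `crux_of_envelope : α → β → crux` through the landed pin lemma `Split.qcdOf_of_pin_body`.
* §2 SUBSEQUENCE FREEDOM.  `QCDOf` binds `∃ reg`, so the conclusion may be witnessed along ANY
  sub-regularisation `k ↦ φ k` of X₀'s: mass scaling, asymptotic scaling, the Schwinger-function limits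
  and every lattice gap restrict to subsequences (`hasMassScaling_sub`, `isQCDAlong_subScheme`,
  `hasLatticeMassGap_sub`), while gap FAILURE restricts when it is eventual (`EventuallyFailsRate`).
  Hence the continuum piece only needs SUBSEQUENTIAL convergence below X₀'s threshold
  (`ContinuumCompletionSub`), provided the envelope's gaplessness is eventual
  (`StrongLatticeChiralEnvelope`): `crux_of_envelope_sub`.  This is the one structural slack in the
  crux not used by any registered line; it softens the convergence half of β and nothing else.
* §3 SUMMIT-STRENGTH CERTIFICATE for the tribunal.  Given the route's own X₀ the crux is literally the
  sub-problem (`crux_iff_qcd_of_X0`); and X₀ is threshold-blind in the strong form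
  `continuumQCDExists_iff_heavyOnly : 0 ≤ M₀ → (X₀ ↔ HeavyOnly M₀)` for EVERY `M₀`, so
  `crux_iff_heavyOnly_handover : crux ↔ (HeavyOnly M₀ → QCD)` for every `M₀ ≥ 0`: the crux is "QCD
  (chiral pin, light-quark existence, lattice AND continuum gap at every positive mass) given only
  that continuum QCD with arbitrarily HEAVY quarks exists".
-/

namespace Summit.QuantumFields.QCD.Cruxes.RobustYangMillsHandover.CensusR1

open Filter Topology
open Summit.QuantumFields.QCD.Theses.HeatSlicedQuarks
open Summit.QuantumFields.QCD.Theorems.RobustYangMillsHandover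
open Literature.MathematicalPhysics.QuantumFieldTheory

variable {Nf : ℕ}

/-! ## §0 Vocabulary -/

/-- X₀-type data ABOVE the offset `M` for one regularisation: OS data that are QCD along the scheme,
non-trivial non-Gaussian glue, non-decoupled flavour-changing pseudoscalars (no gap). -/
def DataAbove (reg : QCDRegularisation Nf) (M : ℝ) : Prop :=
  ∀ t : Fin Nf → ℝ, (∀ f, M < t f) →
    ∃ (z shift : QCDField Nf → ℕ → ℝ) (T : OSData (QCDField Nf) 4),
      IsQCDAlong (reg.scheme t z shift) T ∧ T.IsNontrivial QCDField.glue ∧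
        T.IsNonGaussian QCDField.glue ∧ ∀ f g : Fin Nf, f ≠ g → T.IsNontrivial (QCDField.pseudoRe f g)

/-- The same data WITH a continuum mass gap. -/
def GappedDataAbove (reg : QCDRegularisation Nf) (M : ℝ) : Prop :=
  ∀ t : Fin Nf → ℝ, (∀ f, M < t f) →
    ∃ (z shift : QCDField Nf → ℕ → ℝ) (T : OSData (QCDField Nf) 4),
      (IsQCDAlong (reg.scheme t z shift) T ∧ T.IsNontrivial QCDField.glue ∧
        T.IsNonGaussian QCDField.glue ∧ ∀ f g : Fin Nf, f ≠ g → T.IsNontrivial (QCDField.pseudoRe f g)) ∧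
      ∃ Δ > 0, T.HasMassGap Δ

/-- Pointwise lattice gap at every tuple above `P` (the lattice clause of `QCDOf`, un-pinned). -/
def LatticeGappedAbove (reg : QCDRegularisation Nf) (P : ℝ) : Prop :=
  ∀ t : Fin Nf → ℝ, (∀ f, P < t f) → ∃ Δ > 0, (reg.scheme t 0 0).HasLatticeMassGap Δ

/-- No uniform lattice rate just above `P` (the chirality clause of `QCDOf`, un-pinned). -/
def NoUniformRateAbove (reg : QCDRegularisation Nf) (P : ℝ) : Prop :=
  ∀ ε > (0 : ℝ), ∃ t : Fin Nf → ℝ, (∀ f, P < t f) ∧ ¬ (reg.scheme t 0 0).HasLatticeMassGap ε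

/-! ## §1 The two-piece re-cut: lattice envelope + continuum completion -/

/-- **Piece α — the lattice chiral envelope.**  Every mass-scaling regularisation carrying X₀'s data
at all positive tuples has an offset `P` (its chiral point) above which lattice QCD is pointwise gapped
and just above which no uniform rate survives.  Pure lattice spectral physics: the weak-coupling,
volume- and spacing-uniform lattice gap of SU(3) with Wilson quarks at every super-critical mass
(heavy directions ⊇ the lattice Yang–Mills gap along the PRESCRIBED asymptotically free sequence
`β_k`), and Goldstone gaplessness at the critical mass. -/
def LatticeChiralEnvelope : Prop :=
  ∀ Nf : ℕ, Nf = 2 ∨ Nf = 3 → ∀ reg : QCDRegularisation Nf, reg.HasMassScaling → DataAbove reg 0 →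
    ∃ P : ℝ, LatticeGappedAbove reg P ∧ NoUniformRateAbove reg P

/-- **Piece β — continuum completion down to any pointwise-gapped offset.**  Given X₀'s data above `0`
and pointwise lattice gaps above `P`, continuum QCD data (OS axioms incl. E1, non-trivial non-Gaussian
glue, non-decoupled pseudoscalars) WITH a continuum gap exist at every tuple above `P`, along the same
sequence.  Above X₀'s threshold this is gap transfer; below it, it is the light-quark continuum limit. -/
def ContinuumCompletion : Prop :=
  ∀ Nf : ℕ, Nf = 2 ∨ Nf = 3 → ∀ reg : QCDRegularisation Nf, reg.HasMassScaling → DataAbove reg 0 →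
    ∀ P : ℝ, LatticeGappedAbove reg P → GappedDataAbove reg P

/-- The pin assembled from the three profiles at ONE offset `P` of ONE regularisation. -/
theorem qcdOf_of_pin_pieces (reg : QCDRegularisation Nf) (hMS : reg.HasMassScaling) (P : ℝ)
    (hgap : LatticeGappedAbove reg P) (hχ : NoUniformRateAbove reg P) (hG : GappedDataAbove reg P) :
    QCDOf Nf := by
  refine Split.qcdOf_of_pin_body reg hMS P hχ fun t ht => ?_
  obtain ⟨z, shift, T, ⟨hA, hN, hG', hPs⟩, Δ₁, hΔ₁, hT⟩ := hG t ht
  obtain ⟨Δ₂, hΔ₂, hL⟩ := hgap t ht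
  refine ⟨z, shift, T, hA, hN, hG', hPs, min Δ₁ Δ₂, lt_min hΔ₁ hΔ₂,
    Negative.hasMassGap_anti T (min_le_left _ _) hT, ?_⟩
  exact (Negative.hasLatticeMassGap_scheme_indep reg t 0 0 z shift _).mp
    (Negative.hasLatticeMassGap_anti _ (min_le_right _ _) hL)

/-- **The re-cut decides the crux**: `α → β → RobustYangMillsHandover` (X₀ supplies, per flavour
number, the mass-scaling regularisation and its data above `0`). -/
theorem crux_of_envelope (hα : LatticeChiralEnvelope) (hβ : ContinuumCompletion) :
    RobustYangMillsHandover := by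
  intro hX
  have h : ∀ Nf : ℕ, Nf = 2 ∨ Nf = 3 → QCDOf Nf := fun Nf hNf => by
    obtain ⟨reg, hMS, hbody⟩ := hX Nf hNf
    obtain ⟨P, hgap, hχ⟩ := hα Nf hNf reg hMS hbody
    exact qcdOf_of_pin_pieces reg hMS P hgap hχ (hβ Nf hNf reg hMS hbody P hgap)
  exact ⟨h 2 (Or.inl rfl), h 3 (Or.inr rfl)⟩

/-- Tightness of α ∧ β at the pin: the `QCDOf` witness has exactly this profile above `P = 0`. -/
theorem qcdOf_envelope (h : QCDOf Nf) :
    ∃ reg : QCDRegularisation Nf, reg.HasMassScaling ∧ DataAbove reg 0 ∧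
      LatticeGappedAbove reg 0 ∧ NoUniformRateAbove reg 0 ∧ GappedDataAbove reg 0 := by
  obtain ⟨reg, hMS, hχ, hbody⟩ := h
  refine ⟨reg, hMS, fun t ht => ?_, fun t ht => ?_, hχ, fun t ht => ?_⟩
  · obtain ⟨z, shift, T, hA, hN, hG, hP, -⟩ := hbody t ht
    exact ⟨z, shift, T, hA, hN, hG, hP⟩
  · obtain ⟨z, shift, T, -, -, -, -, Δ, hΔ, -, hL⟩ := hbody t ht
    exact ⟨Δ, hΔ, (Negative.hasLatticeMassGap_scheme_indep reg t z shift 0 0 Δ).mp hL⟩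
  · obtain ⟨z, shift, T, hA, hN, hG, hP, Δ, hΔ, hT, -⟩ := hbody t ht
    exact ⟨z, shift, T, ⟨hA, hN, hG, hP⟩, Δ, hΔ, hT⟩

/-! ## §2 Subsequence freedom -/

/-- The sub-scheme along `φ` (strictly increasing): every datum composed with `φ`. -/
def subScheme (sch : QCDScheme Nf) (φ : ℕ → ℕ) (hφ : StrictMono φ) : QCDScheme Nf where
  a := fun j => sch.a (φ j)
  a_pos := fun j => sch.a_pos (φ j)
  tendsto_a := sch.tendsto_a.comp hφ.tendsto_atTop
  β := fun j => sch.β (φ j)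
  L := fun j => sch.L (φ j)
  tendsto_L := sch.tendsto_L.comp hφ.tendsto_atTop
  mq := fun fl j => sch.mq fl (φ j)
  z := fun s j => sch.z s (φ j)
  shift := fun s j => sch.shift s (φ j)

/-- The sub-regularisation along `φ`. -/
def subReg (reg : QCDRegularisation Nf) (φ : ℕ → ℕ) (hφ : StrictMono φ) : QCDRegularisation Nf where
  a := fun j => reg.a (φ j)
  a_pos := fun j => reg.a_pos (φ j)
  tendsto_a := reg.tendsto_a.comp hφ.tendsto_atTop
  β := fun j => reg.β (φ j)
  L := fun j => reg.L (φ j)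
  tendsto_L := reg.tendsto_L.comp hφ.tendsto_atTop
  mcrit := fun j => reg.mcrit (φ j)
  Zm := fun j => reg.Zm (φ j)
  Zm_pos := fun j => reg.Zm_pos (φ j)

/-- The scheme of the sub-regularisation is the sub-scheme (species data composed with `φ`). -/
theorem subReg_scheme (reg : QCDRegularisation Nf) (φ : ℕ → ℕ) (hφ : StrictMono φ)
    (t : Fin Nf → ℝ) (z shift : QCDField Nf → ℕ → ℝ) :
    (subReg reg φ hφ).scheme t (fun s j => z s (φ j)) (fun s j => shift s (φ j)) =
      subScheme (reg.scheme t z shift) φ hφ := rfl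

/-- … in particular at zero species data. -/
theorem subReg_scheme_zero (reg : QCDRegularisation Nf) (φ : ℕ → ℕ) (hφ : StrictMono φ)
    (t : Fin Nf → ℝ) :
    (subReg reg φ hφ).scheme t 0 0 = subScheme (reg.scheme t 0 0) φ hφ := rfl

/-- Mass scaling restricts to subsequences. -/
theorem hasMassScaling_sub (reg : QCDRegularisation Nf) (φ : ℕ → ℕ) (hφ : StrictMono φ)
    (h : reg.HasMassScaling) : (subReg reg φ hφ).HasMassScaling := by
  obtain ⟨c, hc, ht⟩ := h
  exact ⟨c, hc, ht.comp hφ.tendsto_atTop⟩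

/-- Lattice gaps restrict to subsequences. -/
theorem hasLatticeMassGap_sub (sch : QCDScheme Nf) (φ : ℕ → ℕ) (hφ : StrictMono φ) {Δ : ℝ}
    (h : sch.HasLatticeMassGap Δ) : (subScheme sch φ hφ).HasLatticeMassGap Δ := by
  intro R R' A B
  obtain ⟨C, hC⟩ := h R R' A B
  exact ⟨C, hφ.tendsto_atTop.eventually hC⟩

/-- The lattice Schwinger functions of the sub-scheme are those of the scheme along `φ`. -/
theorem qcdLatticeSchwinger_subScheme (sch : QCDScheme Nf) (φ : ℕ → ℕ) (hφ : StrictMono φ)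
    (j n : ℕ) (σ : Fin n → QCDField Nf) (f : Fin n → SchwartzMap (EuclideanSpace ℝ (Fin 4)) ℝ) :
    qcdLatticeSchwinger (subScheme sch φ hφ) j n σ f = qcdLatticeSchwinger sch (φ j) n σ f := rfl

/-- Being QCD along a scheme restricts to subsequences (asymptotic scaling, the physical branch and
every Schwinger-function limit pass to `φ`). -/
theorem isQCDAlong_subScheme (sch : QCDScheme Nf) (φ : ℕ → ℕ) (hφ : StrictMono φ)
    {T : OSData (QCDField Nf) 4} (h : IsQCDAlong sch T) : IsQCDAlong (subScheme sch φ hφ) T := by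
  obtain ⟨⟨Λ, hΛ, hAF⟩, hm, hconv⟩ := h
  refine ⟨⟨Λ, hΛ, hAF.comp hφ.tendsto_atTop⟩, fun fl => hφ.tendsto_atTop.eventually (hm fl), ?_⟩
  intro n hn σ f F hF hoff
  exact ((hconv n hn σ f F hF hoff).comp hφ.tendsto_atTop).congr fun j =>
    (qcdLatticeSchwinger_subScheme sch φ hφ j n σ f).symm

/-- X₀-type data above `M` restrict to subsequences. -/
theorem dataAbove_sub (reg : QCDRegularisation Nf) (φ : ℕ → ℕ) (hφ : StrictMono φ) {M : ℝ}
    (h : DataAbove reg M) : DataAbove (subReg reg φ hφ) M := by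
  intro t ht
  obtain ⟨z, shift, T, hA, hN, hG, hP⟩ := h t ht
  refine ⟨fun s j => z s (φ j), fun s j => shift s (φ j), T, ?_, hN, hG, hP⟩
  rw [subReg_scheme]
  exact isQCDAlong_subScheme _ φ hφ hA

/-- Pointwise lattice gaps above `P` restrict to subsequences. -/
theorem latticeGappedAbove_sub (reg : QCDRegularisation Nf) (φ : ℕ → ℕ) (hφ : StrictMono φ) {P : ℝ}
    (h : LatticeGappedAbove reg P) : LatticeGappedAbove (subReg reg φ hφ) P := by
  intro t ht
  obtain ⟨Δ, hΔ, hL⟩ := h t ht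
  exact ⟨Δ, hΔ, by rw [subReg_scheme_zero]; exact hasLatticeMassGap_sub _ φ hφ hL⟩

/-- **Eventual failure of the rate `ε`** for one pair of local observables: for every constant `C` the
bound `‖corr‖ ≤ C e^{−ε a_k n}` is violated at ALL large `k` (some admissible volume and separation) —
the subsequence-robust form of `¬ HasLatticeMassGap ε` (a light state present at every fine spacing,
not merely along a subsequence). -/
def EventuallyFailsRate (sch : QCDScheme Nf) (ε : ℝ) : Prop :=
  ∃ (R R' : ℕ) (A : QCDLatticeObservable Nf R) (B : QCDLatticeObservable Nf R'), ∀ C : ℝ,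
    ∀ᶠ k in atTop, ∃ S : ℕ, sch.L k ≤ S ∧ ∃ n : ℕ, n ≤ S ∧
      C * Real.exp (-(ε * (sch.a k * n))) <
        ‖qcdLatticeConnectedCorr (sch.β k) (2 * S + 1) (fun fl => sch.mq fl k) A B n‖

/-- Eventual failure refutes the rate along EVERY subsequence. -/
theorem not_hasLatticeMassGap_sub_of_eventuallyFails (sch : QCDScheme Nf) (φ : ℕ → ℕ)
    (hφ : StrictMono φ) {ε : ℝ} (h : EventuallyFailsRate sch ε) :
    ¬ (subScheme sch φ hφ).HasLatticeMassGap ε := by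
  intro hgap
  obtain ⟨R, R', A, B, hfail⟩ := h
  obtain ⟨C, hC⟩ := hgap R R' A B
  obtain ⟨j, ⟨S, hS, n, hn, hlt⟩, hj⟩ := ((hφ.tendsto_atTop.eventually (hfail C)).and hC).exists
  exact absurd (hj S hS n hn) (not_le.mpr hlt)

/-- … in particular along the identity. -/
theorem not_hasLatticeMassGap_of_eventuallyFails (sch : QCDScheme Nf) {ε : ℝ}
    (h : EventuallyFailsRate sch ε) : ¬ sch.HasLatticeMassGap ε := by
  intro hgap
  obtain ⟨R, R', A, B, hfail⟩ := h
  obtain ⟨C, hC⟩ := hgap R R' A B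
  obtain ⟨j, ⟨S, hS, n, hn, hlt⟩, hj⟩ := ((hfail C).and hC).exists
  exact absurd (hj S hS n hn) (not_le.mpr hlt)

/-- Subsequence-robust gaplessness just above `P`. -/
def StronglyNoUniformRateAbove (reg : QCDRegularisation Nf) (P : ℝ) : Prop :=
  ∀ ε > (0 : ℝ), ∃ t : Fin Nf → ℝ, (∀ f, P < t f) ∧ EventuallyFailsRate (reg.scheme t 0 0) ε

/-- The strong form implies the clause of piece α … -/
theorem noUniformRateAbove_of_strongly (reg : QCDRegularisation Nf) {P : ℝ}
    (h : StronglyNoUniformRateAbove reg P) : NoUniformRateAbove reg P := fun ε hε => by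
  obtain ⟨t, ht, hf⟩ := h ε hε
  exact ⟨t, ht, not_hasLatticeMassGap_of_eventuallyFails _ hf⟩

/-- … and passes to every sub-regularisation. -/
theorem noUniformRateAbove_sub_of_strongly (reg : QCDRegularisation Nf) (φ : ℕ → ℕ)
    (hφ : StrictMono φ) {P : ℝ} (h : StronglyNoUniformRateAbove reg P) :
    NoUniformRateAbove (subReg reg φ hφ) P := fun ε hε => by
  obtain ⟨t, ht, hf⟩ := h ε hε
  exact ⟨t, ht, by rw [subReg_scheme_zero]; exact not_hasLatticeMassGap_sub_of_eventuallyFails _ φ hφ hf⟩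

/-- **Piece α⁺** — the envelope with subsequence-robust gaplessness (physically the same assertion: at
a sub-critical pion mass the light state is present at EVERY fine spacing). -/
def StrongLatticeChiralEnvelope : Prop :=
  ∀ Nf : ℕ, Nf = 2 ∨ Nf = 3 → ∀ reg : QCDRegularisation Nf, reg.HasMassScaling → DataAbove reg 0 →
    ∃ P : ℝ, LatticeGappedAbove reg P ∧ StronglyNoUniformRateAbove reg P

/-- **Piece β_sub** — continuum completion along SOME subsequence: the only convergence the
conclusion's `∃ reg` really asks for below X₀'s threshold. -/
def ContinuumCompletionSub : Prop :=
  ∀ Nf : ℕ, Nf = 2 ∨ Nf = 3 → ∀ reg : QCDRegularisation Nf, reg.HasMassScaling → DataAbove reg 0 →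
    ∀ P : ℝ, LatticeGappedAbove reg P →
      ∃ (φ : ℕ → ℕ) (hφ : StrictMono φ), GappedDataAbove (subReg reg φ hφ) P

/-- β implies β_sub (identity subsequence would do; we restrict honestly along `id`-like `φ = (·)`):
the subsequence form is WEAKER. -/
theorem continuumCompletionSub_of (h : ContinuumCompletion) : ContinuumCompletionSub := by
  intro Nf hNf reg hMS hD P hgap
  refine ⟨fun j => j, strictMono_id, ?_⟩
  intro t ht
  obtain ⟨z, shift, T, ⟨hA, hN, hG, hP⟩, Δ, hΔ, hT⟩ := h Nf hNf reg hMS hD P hgap t ht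
  refine ⟨fun s j => z s j, fun s j => shift s j, T, ⟨?_, hN, hG, hP⟩, Δ, hΔ, hT⟩
  have e : (subReg reg (fun j => j) strictMono_id).scheme t (fun s j => z s j) (fun s j => shift s j) =
      subScheme (reg.scheme t z shift) (fun j => j) strictMono_id := rfl
  rw [e]
  exact isQCDAlong_subScheme _ _ _ hA

/-- **The subsequence re-cut decides the crux**: `α⁺ → β_sub → RobustYangMillsHandover`, the `QCDOf`
witness being X₀'s regularisation restricted to `φ` and shifted to the pin. -/
theorem crux_of_envelope_sub (hα : StrongLatticeChiralEnvelope) (hβ : ContinuumCompletionSub) :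
    RobustYangMillsHandover := by
  intro hX
  have h : ∀ Nf : ℕ, Nf = 2 ∨ Nf = 3 → QCDOf Nf := fun Nf hNf => by
    obtain ⟨reg, hMS, hbody⟩ := hX Nf hNf
    obtain ⟨P, hgap, hχ⟩ := hα Nf hNf reg hMS hbody
    obtain ⟨φ, hφ, hG⟩ := hβ Nf hNf reg hMS hbody P hgap
    exact qcdOf_of_pin_pieces (subReg reg φ hφ) (hasMassScaling_sub reg φ hφ hMS) P
      (latticeGappedAbove_sub reg φ hφ hgap) (noUniformRateAbove_sub_of_strongly reg φ hφ hχ) hG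
  exact ⟨h 2 (Or.inl rfl), h 3 (Or.inr rfl)⟩

/-! ## §3 Summit-strength certificate -/

/-- Given the route's own engine output X₀, the crux IS the sub-problem statement. -/
theorem crux_iff_qcd_of_X0 (hX : ContinuumQCDExists) : RobustYangMillsHandover ↔ _root_.QCD :=
  ⟨fun h => h hX, fun q _ => q⟩

/-- Heavy-only continuum existence: X₀'s data above the offset `M₀` only. -/
def HeavyOnly (M₀ : ℝ) : Prop :=
  ∀ Nf : ℕ, Nf = 2 ∨ Nf = 3 → ∃ reg : QCDRegularisation Nf, reg.HasMassScaling ∧ DataAbove reg M₀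

/-- **Threshold blindness, strong form**: for EVERY `M₀ ≥ 0`, X₀ is equivalent to heavy-only existence
above `M₀` (restrict; conversely shift `m_crit` by `M₀`, landed `Negative.continuumQCDExists_iff_threshold`). -/
theorem continuumQCDExists_iff_heavyOnly {M₀ : ℝ} (hM : 0 ≤ M₀) : ContinuumQCDExists ↔ HeavyOnly M₀ := by
  constructor
  · intro hX Nf hNf
    obtain ⟨reg, hMS, hbody⟩ := hX Nf hNf
    exact ⟨reg, hMS, fun t ht => hbody t fun f => hM.trans_lt (ht f)⟩
  · intro h
    refine Negative.continuumQCDExists_iff_threshold.mpr fun Nf hNf => ?_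
    obtain ⟨reg, hMS, hbody⟩ := h Nf hNf
    exact ⟨M₀, hM, reg, hMS, hbody⟩

/-- All heavy-only existence statements are ONE proposition. -/
theorem heavyOnly_iff_heavyOnly {M₀ M₁ : ℝ} (h₀ : 0 ≤ M₀) (h₁ : 0 ≤ M₁) : HeavyOnly M₀ ↔ HeavyOnly M₁ :=
  (continuumQCDExists_iff_heavyOnly h₀).symm.trans (continuumQCDExists_iff_heavyOnly h₁)

/-- **The crux at strength**: for every `M₀ ≥ 0`, `RobustYangMillsHandover ↔ (HeavyOnly M₀ → QCD)` —
full QCD (chiral pin, light-quark continuum existence, lattice and continuum gap at every positive mass,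
`N_f = 2` and `3`) from the existence of continuum QCD with arbitrarily heavy quarks only. -/
theorem crux_iff_heavyOnly_handover {M₀ : ℝ} (hM : 0 ≤ M₀) :
    RobustYangMillsHandover ↔ (HeavyOnly M₀ → _root_.QCD) :=
  ⟨fun h hH => h ((continuumQCDExists_iff_heavyOnly hM).mpr hH),
    fun h hX => h ((continuumQCDExists_iff_heavyOnly hM).mp hX)⟩

/-- The minimal-completion fact in this vocabulary (cf. `CensusS6.completes_iff`): any `C'` completing
the route's `closes` in the slot of the crux implies the crux. -/
theorem crux_of_completion (C' : Prop) (hc : ContinuumQCDExists → C' → _root_.QCD) (h : C') :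
    RobustYangMillsHandover := fun hX => hc hX h

end Summit.QuantumFields.QCD.Cruxes.RobustYangMillsHandover.CensusR1
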